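import Summits.ValiantsHypothesis.ValiantsHypothesis.Theorems.TwoAdicLadderTwoIntegralNormalisationPrecisionUniform

/-!
# TwoAdicLadder — crux `TwoIntegralNormalisation` (stmt-ValiantsHypothesis-5947), line `birth`,
# stub `stub_halfElim`: the REGISTERED (uniform) stub in finite-precision currency

Companion to `…PrecisionUniform.lean` (which proves `TwoIntegralNormalisation ↔ HalfElimGlobal ↔
DivElimGlobal`). Here the same transfer (`complexity_perPoly_localization_le_of_twoAdic`:
precision-uniform small circuits over admissible finite rings give ONE exact small circuit over a
`2`-adically integral number ring) is applied to the REGISTERED signature of `stub_halfElim`: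

* `halfElim_iff_uniformPrecision` — the registered stub (uniform `1/2`-elimination into some
  `𝓞_(𝔭)`, one exponent `d` for all `n, s`) is EQUIVALENT to its finite-precision form: one `d`
  such that `L_K(per_n) ≤ s` over a number field gives, for EVERY precision `k`, an admissible ring
  `R_k` (finite commutative principal ideal ring, `2` nilpotent, `2^k ≠ 0`) with
  `L_{R_k}(per_n) ≤ (s + n + 2)^d`.

Together with `halfElim_iff_divElim` (`…DivisionForm.lean`) the registered stub now has three
kernel-checked equivalent forms: uniform `1/2`-elimination, uniform exact division by powers of `2`
(`M`-free), and uniform precision-independent circuits over admissible rings. Honest framing: all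
three are OPEN; nothing here is progress on VP ≠ VNP.
-/

noncomputable section

open MvPolynomial

-- the summit and the problem share the name `ValiantsHypothesis` (D-0017 single-conjunct layout)
set_option linter.dupNamespace false

namespace Summit.ValiantsHypothesis.ValiantsHypothesis.Theorems.TwoAdicLadder.TwoIntegralNormalisation

open Summit.ValiantsHypothesis.ValiantsHypothesis.Theses.TwoAdicLadder
open NumberField Literature.Computability.AlgebraicComplexity

/-! ### The registered (uniform) stub in finite-precision currency -/

/-- Envelope for the transfer bound in the `(s + n + 2)^d` currency: with `B = s + n + 2 ≥ 2`,
`21877 · (n² + n + B^d + 2)²⁶ ≤ B^(26 (d + 4) + 15)`. [folklore] -/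
theorem transfer_envelope (s n d : ℕ) :
    21877 * (n * n + n + (s + n + 2) ^ d + 2) ^ 26 ≤ (s + n + 2) ^ (26 * (d + 4) + 15) := by
  set B := s + n + 2 with hB
  have hB2 : 2 ≤ B := by omega
  have hnB : n ≤ B := by omega
  have h1 : n * n ≤ B ^ 2 := by nlinarith
  have h2 : B ≤ B ^ 2 := by nlinarith
  have hBd : B ^ 2 ≤ B ^ (d + 2) := Nat.pow_le_pow_right (by omega) (by omega)
  have hBd' : B ^ d ≤ B ^ (d + 2) := Nat.pow_le_pow_right (by omega) (by omega)
  have h4 : 4 ≤ B ^ 2 := by nlinarith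
  have hsum : n * n + n + B ^ d + 2 ≤ B ^ (d + 4) := by
    calc n * n + n + B ^ d + 2 ≤ B ^ 2 + B ^ 2 + B ^ (d + 2) + B ^ 2 := by omega
      _ ≤ 4 * B ^ (d + 2) := by omega
      _ ≤ B ^ 2 * B ^ (d + 2) := Nat.mul_le_mul_right _ h4
      _ = B ^ (d + 4) := by rw [← pow_add]; congr 1; omega
  have hc : 21877 ≤ B ^ 15 := by
    calc 21877 ≤ 2 ^ 15 := by norm_num
      _ ≤ B ^ 15 := Nat.pow_le_pow_left hB2 15
  calc 21877 * (n * n + n + B ^ d + 2) ^ 26 ≤ B ^ 15 * (B ^ (d + 4)) ^ 26 :=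
        Nat.mul_le_mul hc (Nat.pow_le_pow_left hsum 26)
    _ = B ^ (26 * (d + 4) + 15) := by
        rw [← pow_mul, ← pow_add]
        congr 1
        ring

/-- **The registered stub `⟺` its finite-precision (uniform-in-`k`) form.** The signature of
`stub_halfElim` (left: uniform `1/2`-elimination into some `𝓞_(𝔭)`) is EQUIVALENT to: one exponent
`d` such that `L_K(per_n) ≤ s` over a number field gives, for EVERY precision `k`, an admissible
ring `R` (finite commutative principal ideal ring, `2` nilpotent, `2^k ≠ 0`) with
`L_R(per_n) ≤ (s + n + 2)^d` — the same `d` for all `k`. `→`: reduce `𝓞_(𝔭)` modulo powers of `𝔭`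
(landed `stub_chainRingReduction`); `←`: the transfer `complexity_perPoly_localization_le_of_twoAdic`
(precision-uniform small circuits give ONE exact small circuit over a `2`-integral number ring,
exponent `26 (d + 4) + 15`). [folklore] -/
theorem halfElim_iff_uniformPrecision :
    (∃ d : ℕ, ∀ (n s : ℕ) (K : Type) [Field K] [NumberField K],
      complexity (perPoly (Fin n) K) ≤ s →
        ∃ (K' : Type) (_ : Field K') (_ : NumberField K')
          (P : Ideal (𝓞 K')) (_ : P.IsPrime), (2 : 𝓞 K') ∈ P ∧
          complexity (perPoly (Fin n) (Localization.AtPrime P)) ≤ (s + n + 2) ^ d) ↔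
    (∃ d : ℕ, ∀ (n s : ℕ) (K : Type) [Field K] [NumberField K],
      complexity (perPoly (Fin n) K) ≤ s → ∀ k : ℕ,
        ∃ (R : Type) (_ : CommRing R) (_ : Fintype R),
          IsPrincipalIdealRing R ∧ IsNilpotent (2 : R) ∧ (2 : R) ^ k ≠ 0 ∧
          complexity (perPoly (Fin n) R) ≤ (s + n + 2) ^ d) := by
  constructor
  · rintro ⟨d, hd⟩
    refine ⟨d, fun n s K _ _ hs k => ?_⟩
    obtain ⟨K', hF, hNF, P, hP, h2P, hle⟩ := hd n s K hs
    obtain ⟨R, hR, hRf, hPIR, hnil, hne, ⟨φ⟩⟩ := @stub_chainRingReduction K' hF hNF P hP h2P k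
    refine ⟨R, hR, hRf, hPIR, hnil, hne, ?_⟩
    have hmap := ArithCircuit.complexity_map_le φ (perPoly (Fin n) (Localization.AtPrime P))
    rw [map_perPoly] at hmap
    exact hmap.trans hle
  · rintro ⟨d, hd⟩
    refine ⟨26 * (d + 4) + 15, fun n s K _ _ hs => ?_⟩
    have h := hd n s K hs
    choose Rn instR _instF _hPIR h2 hk hc using h
    obtain ⟨K', hF, hNF, P', hP', h2P', hle⟩ :=
      @complexity_perPoly_localization_le_of_twoAdic n ((s + n + 2) ^ d) Rn instR h2 hk hc
    exact ⟨K', hF, hNF, P', hP', h2P', hle.trans (transfer_envelope s n d)⟩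

end Summit.ValiantsHypothesis.ValiantsHypothesis.Theorems.TwoAdicLadder.TwoIntegralNormalisation

end
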